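/-
Copyright: cell `pub-ymgap` (HUMAN RULING D-0062), Track A of `YM-PLAN.md`, DAG node N20 (= NE7b); R134 acceleration seat
`pub-ymgap-dag-n20-c` (strategy s1, generation 22), module 60.  Released under the licence of the surrounding project.
-/
import Summits.QuantumFields.YangMills.Theorems.BalabanUVNodesN20LCSMinimiserEnergyComparison
import HarnessLib

/-!
# YM-DAG node N20 (= NE7b), row s1, module 60: THE (T) LETTER STRUCK — the instance for arbitrary pinned families modulo (W♮) ALONE
# (`B ↦ B_J` inside the regime), and AT KEYS ROOTED AT STEP 0 the class weight bound and the row's two NAMED PROPS with NO displayed letter of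
# Bałaban's kind (LCS-0 is a theorem, `hreg` is module 59's theorem)

Track A of `YM-PLAN.md` (cell `pub-ymgap`, HUMAN RULING D-0062), node **N20** = spine estimate NE7b (`T4WeightBudget.RelWeightBound`, NOT
PRINTED, NOT PROVED).  Seat `pub-ymgap-dag-n20-c` (R134, s1), generation 22, module 60.  Kernel theorems only: 0 `def`, 0 `sorry`, standard
axioms; COUNT-NEUTRAL.  Composition BY NAME of module 59 (`…N20LCSMinimiserEnergyComparison`: `hThm1_of_crude`, `hreg_canon_of_crude` — the regularity
letter PROVED at every pinned level for `B ≥ B_k := √(N·n⋆_k)·L^{2(k+1)}`, `n⋆_k = d²·(9·sideχ_k)^d`), module 52 §1 (`…N20LCSSmallCouplingRegime`), module 35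
(`…N20LCSLabelTowerAtResidualOfRecordHalves`: keys rooted at step `0` modulo `hreg` ONLY) and module 51 (`…N20LCSCanonicalSkeleton`: the canonical regions, their
size `card_canon_le` and overlap count `card_filter_not_disjoint_canon_le`, the skeleton `exists_canon_skeleton`).  Nothing is re-declared.

WHAT THIS FILE PROVES.
* §1 `hThm1_levels_of_crude` — (T♮) at ALL pinned levels `j ∈ J` and all χ_{j+1}-cubes, in the EXACT `hThm1` binder shape of modules 52–56, from
  `∀ j ∈ J, √(N·n⋆_j) ≤ B·η_{j+1}²` (`B ≥ B_J := max_j B_j`) and the geometric letters (`1 ≤ M₁`, torus divisibility `L^{j+1}M₁ ∣ 2L^{m+K}`, `LM₁ ≤ sideχ_j`).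
* §2 ★★★ `sum_admS_integral_le_rec_pinnedLevels_smallCouplings_of_any_crude` — module 52 §1 (THE INSTANCE for ARBITRARY pinned families at the per-level
  small-coupling threshold) with its hypothesis `hThm1` STRUCK: the class weight of label histories pinned at the levels `J` is
  `≤ exp(−(δ·C·A·M_h²∕39^d)·Σ_j #D_j)·∫ρ₀` MODULO (W♮) ALONE («LCS-j on the hull of window-admissible pins»), in the regime
  `hsmall : 4N·B²·(C·A·M_h² + log m_j∕δ) ≤ p₀(g_{j+1})²` at a `B` dominating the level thresholds `B_j`.
* §3 ★★★ `sum_admS_integral_le_rec_rootedAtZero_crude` — KEYS ROOTED AT THE FIRST STEP, ARBITRARY pinned family `D` of χ₁-cubes, NO LETTER OF BAŁABAN's KIND: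
  `∃ n, #D ≤ 39^d·n ∧ (class weight at level Kc+1) ≤ (m₀·e^{Cδ₀ − δ₀·g₀⁻²·(ε₁∕B)²∕(2N)})ⁿ·∫ρ₀`, `m₀ = d²(9LM₂R₁)^d`, for every `B ≥ B₀` (module 35's
  `…_rec_rootedAtZero_of_overlap` — LCS-0 inside, a theorem since module 7 — with `hreg` := module 59 at the canonical regions, overlap `K₀ = 39^d` and size
  `m₀` from module 51); ★★★ `halves_rec_rootedAtZero_crude` — THE ROW's TWO NAMED PROPS `PointwiseExtraction ∧ LocCondStability` on Bałaban's label tower at the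
  residual of record for keys rooted at step `0`, on a `39^d`-dense skeleton `D′ ⊆ D` of ANY pinned family, with NO displayed hypothesis beyond the carriers'
  bookkeeping rows and numerics letters (module 35's `halves_rec_rootedAtZero` ∘ module 59 ∘ module 51's skeleton).

WHAT THIS MEANS FOR N20 (located, honest).  The s1 row's residual (HOME `N20-S1-RESIDUAL.md`) loses its second item: after this file the instance is
displayed modulo (W♮) at the pinned levels `j ≥ 1` (+ the regime (R) read at `B ≥ B_J`) and NOTHING ELSE; at `J = {0}` it is a THEOREM.  The price is
located in module 59's doc: `B_J ~ L^{4·max J}` is level-DEPENDENT, so (R) at `B_J` is met only at fixed depth (`p₀ > 2r`); the level-uniform `B` is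
[Balaban1985Variational] Thm 1 (8) (K0's pen) and would make (R) uniform.  The best exponent at level `0` is at `B = B₀`:
`δ₀·g₀⁻²·ε₁²∕(2N·B₀²) = δ₀·(g₁∕g₀)²·p₀(g₁)²·L^{−8}∕(2N²·d²·(9·L²M₂R₁)^d)` — gainful once `p₀(g₁)² ≫ (log g₁⁻²)^{4r}`, i.e. `p₀ > 2r` and `g₁` small.

HONEST FRAMING.  By-name composition; nothing of Bałaban's asserted ([Balaban1985Variational] Thm 1 is NOT claimed — module 59's crude bound replaces its USE
at fixed depth); NE7b NOT PRINTED ∕ NOT PROVED; (α)-instance 0∕1; N20 NOT discharged; typed 28∕28, discharged count untouched; one finite four-torus at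
fixed `ε` — NOT ℝ⁴, NOT infinite volume, NOT OS, NOT a mass gap, NOT Clay.

References (LOCATORS): T. Bałaban, CMP 119 (1988) 243–285 [Balaban1988Convergent] ((2.12)–(2.13) pp.256–257, (2.16)–(2.17) p.257, (3.2) p.265, (3.26)–(3.30)
pp.270–271); CMP 102 (1985) 277–309 [Balaban1985Variational] (Thm 1 (8)–(9) p.279); CMP 122 (1989) 175–202 [Balaban1989LargeFieldI] ((0.3)–(0.5) pp.176–177).
-/

set_option autoImplicit false

noncomputable section

open scoped BigOperators

namespace Summit.QuantumFields.YangMills.BalabanUVNodes.N20LCSThm1Crude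

open MeasureTheory
open Literature.MathematicalPhysics.QuantumFieldTheory.Balaban1983to89
open Literature.MathematicalPhysics.QuantumFieldTheory.Balaban1983to89.T4Continuum
open Literature.MathematicalPhysics.QuantumFieldTheory.Balaban1983to89.B14.Eq218Concrete
open Literature.MathematicalPhysics.QuantumFieldTheory.Balaban1983to89.Node00
open B15DeterminingSets B14.Eq213DetSet B14.Eq216Concrete B14.Eq213MaximalDomains B15Eq112TorusCover B14DomainGeom
open Literature.MathematicalPhysics.QuantumFieldTheory.BalabanImbrieJaffe1984to88.BIJ85Eq453GaugeField (qsstarGIter0)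
open ExpMeanLog (deltaSU)
open Summit.QuantumFields.BalabanUV.T4Continuum.B16HistoryIndexedRepr (GoodClass)
open Summit.QuantumFields.BalabanUV.T4Continuum.B16HistoryReprChain
open Summit.QuantumFields.BalabanUV.T4Continuum.NE7b.PrefixExtraction (admS)
open Summit.QuantumFields.BalabanUV.T4Continuum.NE7b.LocalConditionalStability (LocCondStability PointwiseExtraction)
open Summit.QuantumFields.YangMills.BalabanUVNodes.N20LCSLabelTower
open Summit.QuantumFields.YangMills.BalabanUVNodes.N20LCSAvgDominationRegion (boxRegion)
open Summit.QuantumFields.YangMills.BalabanUVNodes.N20LCSCanonicalSkeleton (exists_canon_skeleton card_canon_le card_filter_not_disjoint_canon_le)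
open Summit.QuantumFields.YangMills.BalabanUVNodes.N20LCSSmallCouplingRegime (sum_admS_integral_le_rec_pinnedLevels_smallCouplings_of_any)
open Summit.QuantumFields.YangMills.BalabanUVNodes.N20LCSLabelTowerAtResidualOfRecordHalves (halves_rec_rootedAtZero sum_admS_integral_le_rec_rootedAtZero_of_overlap)
open Summit.QuantumFields.YangMills.BalabanUVNodes.N20LCSMinimiserEnergyComparison (hThm1_of_crude hreg_canon_of_crude)

/-! ## §1  (T♮) at all pinned levels, from the level thresholds `B_j` -/

section Levels

variable (F : T4Family) (N : ℕ) [NeZero N] (ν : Stage7Numerics) (p : B12.RunParams) (g : ℕ → ℝ)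

/-- ★★ **(T♮) AT EVERY PINNED LEVEL AND EVERY CUBE — THE `hThm1` BINDER OF MODULES 52–56, PROVED** for `B` dominating the level thresholds
(`√(N·n⋆_j) ≤ B·η_{j+1}²` for `j ∈ J`), under the geometric letters (`1 ≤ M₁`, `L^{j+1}M₁ ∣ 2L^{m+K}`, `LM₁ ≤ sideχ_j`, range `j + 1 ≤ m + K`) and `0 < ε_{j+1}`
— module 59's `hThm1_of_crude` level by level. [cite: Balaban1985Variational, Thm 1 (8)–(9) p.279; Balaban1988Convergent, (2.16)–(2.17) p.257] -/
theorem hThm1_levels_of_crude (J : Finset ℕ) (hJm : ∀ j ∈ J, j + 1 ≤ (F.P p.K).m + (F.P p.K).K) (hM : 1 ≤ ν.M₁)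
    (hdiv : ∀ j ∈ J, side (F.P p.K).L ν.M₁ (j + 1) ∣ (F.P p.K).sitesPerDir 0)
    (hsz : ∀ j ∈ J, side (F.P p.K).L ν.M₁ 1 ≤ sideχ F ν p g j)
    {B : ℝ} (hB0 : 0 < B) (hε : ∀ j ∈ J, 0 < epsOfRecord ν g (j + 1))
    (hB : ∀ j ∈ J, Real.sqrt ((N : ℝ) * (((F.P p.K).d ^ 2 * (9 * sideχ F ν p g j) ^ (F.P p.K).d : ℕ) : ℝ)) ≤ B * (F.P p.K).eta (j + 1) ^ 2) :
    ∀ j ∈ J, ∀ (c : Iχ F ν p g j) (V' : GaugeField (F.P p.K) (j + 1) (SU N)) (U₀ : GaugeField (F.P p.K) 0 (SU N)),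
      IsMinimizer (avOfRecord F N p.K) {U | PlaqSmall (ν.εreg * (F.P p.K).eta (j + 1) ^ 2) U}
          (Bj ν.M₁ (cubeEnl (F.P p.K) (sideχ F ν p g j) c 4) (j + 1)) (avgFamily (avOfRecord F N p.K) (qsstarGIter0 (j + 1) V')) U₀ →
      (∀ p' : Plaq (F.P p.K) (j + 1), embIter (j + 1) p'.src ∈ cubeEnl (F.P p.K) (sideχ F ν p g j) c 4 →
        dist1 (GaugeField.plaqHol V' p') < epsOfRecord ν g (j + 1) / B) →
      PlaqSmallOn (plaqInside (cubeEnl (F.P p.K) (sideχ F ν p g j) c 1)) (epsOfRecord ν g (j + 1) * (F.P p.K).eta (j + 1) ^ 2) U₀ :=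
  fun j hj c => hThm1_of_crude F N ν p g (hJm j hj) hM (hdiv j hj) (hsz j hj) hB0 (hε j hj) (hB j hj) c

end Levels

/-! ## §2  Module 52 §1 with (T) STRUCK: the instance for arbitrary pinned families modulo (W♮) alone -/

section Instance

variable (F : T4Family) (N : ℕ) [NeZero N] (ν : Stage7Numerics) (M : ℕ) (p : B12.RunParams) (g : ℕ → ℝ) (A₁ : ℝ)

open Classical in
/-- ★★★ **THE INSTANCE FOR ARBITRARY PINNED FAMILIES, MODULO (W♮) ALONE**: module 52 §1 (`sum_admS_integral_le_rec_pinnedLevels_smallCouplings_of_any`) with its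
[Balaban1985Variational]-shaped hypothesis `hThm1` REPLACED by the level thresholds `hB : ∀ j ∈ J, √(N·n⋆_j) ≤ B·η_{j+1}²` (module 59) and the geometric letters.
What remains displayed: (W♮) «LCS-j on the hull of the (3.2) window's canonical regions» (THE wall), the per-level regime `hsmall` read AT THIS `B`, and the
side conditions among free constants.  LOCATED: `B ≥ B_J ~ L^{4·max J}` makes `hsmall` a fixed-depth regime (module 59's doc).
[cite: Balaban1988Convergent, (3.26)–(3.30) pp.270–271, (2.16)–(2.17) p.257; Balaban1989LargeFieldI, (0.3)–(0.5) pp.176–177; Balaban1985Variational, Thm 1 (8)–(9) p.279] -/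
theorem sum_admS_integral_le_rec_pinnedLevels_smallCouplings_of_any_crude {ρ₀ : cfgOfRecord F N p.K 0 → ℝ}
    (hρ : (bddMeas (cfgOfRecord F N p.K 0)).Gd ρ₀) (h0 : ∀ U, 0 ≤ ρ₀ U) (hM₂ : 0 < ν.M₂) (hM₁ : 1 ≤ ν.M₁)
    (J : Finset ℕ) (hJ : ∀ j ∈ J, j < p.K) (hJm : ∀ j ∈ J, j + 1 ≤ (F.P p.K).m + (F.P p.K).K)
    (hdiv : ∀ j ∈ J, side (F.P p.K).L ν.M₁ (j + 1) ∣ (F.P p.K).sitesPerDir 0)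
    (hsz : ∀ j ∈ J, side (F.P p.K).L ν.M₁ 1 ≤ sideχ F ν p g j)
    (D : (j : ℕ) → Finset (Iχ F ν p g j)) {B : ℝ} (hB : 0 < B)
    (hg : ∀ j ∈ J, 0 < g (j + 1)) (hεk : ∀ j ∈ J, 0 < epsOfRecord ν g (j + 1))
    (hεη : ∀ j ∈ J, 0 < epsOfRecord ν g (j + 1) * (F.P p.K).eta (j + 1) ^ 2)
    (hBJ : ∀ j ∈ J, Real.sqrt ((N : ℝ) * (((F.P p.K).d ^ 2 * (9 * sideχ F ν p g j) ^ (F.P p.K).d : ℕ) : ℝ)) ≤ B * (F.P p.K).eta (j + 1) ^ 2)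
    {α C a₀ δ : ℝ} (hα : 0 < α)
    (hguard : (((((F.P p.K).d + 2) * (F.P p.K).L : ℕ) : ℝ) ^ 2 / 4) * Real.sqrt (2 * (Fintype.card (Fin N) : ℝ) * α) < deltaSU (Fin N))
    (hC : 0 ≤ C) (hδ : 0 < δ)
    (hδa : δ * ((2 * (Fintype.card (Fin N) : ℝ) * (((F.P p.K).L : ℝ) ^ 2 + 6 * ((((F.P p.K).d + 2) * (F.P p.K).L : ℕ) : ℝ) ^ 2) ^ 2 +
        2 / α) * (((2 * (((F.P p.K).d + 3) * (F.P p.K).L + 2) + 1) ^ (F.P p.K).d * (F.P p.K).d ^ 2 : ℕ) : ℝ)) ≤ a₀)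
    (hsmall : ∀ j ∈ J, 4 * (Fintype.card (Fin N) : ℝ) * B ^ 2 *
      (C * ((2 * (Fintype.card (Fin N) : ℝ) * (((F.P p.K).L : ℝ) ^ 2 + 6 * ((((F.P p.K).d + 2) * (F.P p.K).L : ℕ) : ℝ) ^ 2) ^ 2 + 2 / α) *
          (((2 * (((F.P p.K).d + 3) * (F.P p.K).L + 2) + 1) ^ (F.P p.K).d * (F.P p.K).d ^ 2 : ℕ) : ℝ)) *
          (((2 * (((F.P p.K).d + 3) * (F.P p.K).L + 2) + 1) ^ (F.P p.K).d * (F.P p.K).d ^ 2 : ℕ) : ℝ) +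
        Real.log (((F.P p.K).d ^ 2 * (9 * ((F.P p.K).L * ν.M₂ * RkOfRecord (F.P p.K).L ν.r (g (j + 1)))) ^ (F.P p.K).d : ℕ) : ℝ) / δ) ≤
      p0Profile ν.A₀ ν.p₀ (g (j + 1)) ^ 2)
    (K' : ℕ) (E : (j : ℕ) → (Fin j → LabelPat F ν p g) → Finset (LbOfRecord F ν p g j)) (hE : ∀ j ∈ J, ∀ h t, t ∈ E j h → D j ⊆ t.1)
    (hW : ∀ j ∈ J, j < K' → ∀ h : Fin j → LabelPat F ν p g,
      h ∈ admS (labelTowerOfRecord F N ν M p g A₁ (zeta316OfRecord F N ν M A₁)) (labelPattern F ν p g E) j →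
      ∀ a : ℝ, 0 ≤ a → a ≤ a₀ → ∀ X : Finset (Plaq (F.P p.K) j),
        (∀ q ∈ X, ∃ c ∈ cubes32 F ν M p g j (seqOfHist F ν M p g j h),
          ∃ p' ∈ (Finset.univ.filter fun q : Plaq (F.P p.K) (j + 1) => embIter (j + 1) q.src ∈ cubeEnl (F.P p.K) (sideχ F ν p g j) c 4),
            q ∈ boxRegion (emb p'.src) (((F.P p.K).d + 3) * (F.P p.K).L + 2)) →
        ∫ U, Real.exp (a * ((g (j + 1)) ^ 2)⁻¹ * ∑ q ∈ X, (1 - reTr (GaugeField.plaqHol U q))) *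
            (labelTowerOfRecord F N ν M p g A₁ (zeta316OfRecord F N ν M A₁)).eterm ρ₀ j h U ∂(lawOfRecord F N p.K j) ≤
          Real.exp (C * a * X.card) * ∫ U, (labelTowerOfRecord F N ν M p g A₁ (zeta316OfRecord F N ν M A₁)).eterm ρ₀ j h U ∂(lawOfRecord F N p.K j)) :
    ∑ h ∈ admS (labelTowerOfRecord F N ν M p g A₁ (zeta316OfRecord F N ν M A₁)) (labelPattern F ν p g E) K',
        ∫ x, (labelTowerOfRecord F N ν M p g A₁ (zeta316OfRecord F N ν M A₁)).eterm ρ₀ K' h x ∂(lawOfRecord F N p.K K') ≤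
      Real.exp (-(δ * (C * ((2 * (Fintype.card (Fin N) : ℝ) * (((F.P p.K).L : ℝ) ^ 2 + 6 * ((((F.P p.K).d + 2) * (F.P p.K).L : ℕ) : ℝ) ^ 2) ^ 2 +
              2 / α) * (((2 * (((F.P p.K).d + 3) * (F.P p.K).L + 2) + 1) ^ (F.P p.K).d * (F.P p.K).d ^ 2 : ℕ) : ℝ)) *
              (((2 * (((F.P p.K).d + 3) * (F.P p.K).L + 2) + 1) ^ (F.P p.K).d * (F.P p.K).d ^ 2 : ℕ) : ℝ))) / (39 : ℝ) ^ (F.P p.K).d *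
          ∑ j ∈ (Finset.range K').filter (· ∈ J), ((D j).card : ℝ)) *
        ∫ U, ρ₀ U ∂(fieldMeasure (F.P p.K) 0 (SU N)) :=
  sum_admS_integral_le_rec_pinnedLevels_smallCouplings_of_any F N ν M p g A₁ hρ h0 hM₂ J hJ D hB hg hεη
    (hThm1_levels_of_crude F N ν p g J hJm hM₁ hdiv hsz hB hεk hBJ) hα hguard hC hδ hδa hsmall K' E hE hW

end Instance

/-! ## §3  Keys rooted at the first step: class weight bound and the two named Props with NO letter of Bałaban's kind -/

section RootedAtZero

variable (F : T4Family) (N : ℕ) [NeZero N] (ν : Stage7Numerics) (M : ℕ) (p : B12.RunParams) (g : ℕ → ℝ)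

open Classical in
/-- ★★★ **THE CLASS WEIGHT BOUND FOR KEYS ROOTED AT STEP 0, ARBITRARY PINNED FAMILY, NO DISPLAYED LETTER OF BAŁABAN's KIND.**  For every family `D` of χ₁-cubes
and every `B ≥ B₀` (`√(N·n⋆₀) ≤ B·η₁²`): the label histories of length `Kc + 1` whose first label's (3.2) family contains `D` weigh, at level `Kc + 1`, at most
`(m₀·e^{Cδ₀ − δ₀·g₀⁻²·(ε₁∕B)²∕(2N)})ⁿ·∫ρ₀ dU₀` for some `n` with `#D ≤ 39^d·n`, `m₀ = d²·(9·L·M₂·R₁)^d` — module 35's `…_rec_rootedAtZero_of_overlap` (ONE PEIERLS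
FACTOR PER SKELETON CUBE; LCS-0 = module 7 inside) with its regularity letter `hreg` SUPPLIED by module 59 at the canonical regions `R♮₀(c)` (threshold `ε₁∕B`),
their size by module 51's `card_canon_le` and their overlap count `K₀ = 39^d` by module 51's `card_filter_not_disjoint_canon_le`.  Letters: numerics∕geometry only
(`1 ≤ K`, `4N ≤ g₀⁻²`, `0 < M₂`, `1 ≤ M₁`, `LM₁ ∣ 2L^{m+K}`, `LM₁ ≤ sideχ₀`, `0 < ε₁`, `0 < B`, `B ≥ B₀`).
[cite: Balaban1988Convergent, (3.2) p.265, (3.26)–(3.30) pp.270–271, (2.16)–(2.17) p.257; Balaban1989LargeFieldI, (0.3)–(0.5) pp.176–177] -/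
theorem sum_admS_integral_le_rec_rootedAtZero_crude :
    ∃ δ₀ : ℝ, 0 < δ₀ ∧ ∃ C : ℝ, 0 ≤ C ∧ ∀ (_hK : 1 ≤ p.K) (g₀ E₀ : ℝ), 4 * N ≤ g₀⁻¹ ^ 2 → ∀ (A₁ : ℝ)
      (_hM₂ : 0 < ν.M₂) (_hM₁ : 1 ≤ ν.M₁) (_hm : 1 ≤ (F.P p.K).m + (F.P p.K).K)
      (_hdiv : side (F.P p.K).L ν.M₁ 1 ∣ (F.P p.K).sitesPerDir 0) (_hsz : side (F.P p.K).L ν.M₁ 1 ≤ sideχ F ν p g 0)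
      (B : ℝ), 0 < B → 0 < epsOfRecord ν g 1 →
      Real.sqrt ((N : ℝ) * (((F.P p.K).d ^ 2 * (9 * sideχ F ν p g 0) ^ (F.P p.K).d : ℕ) : ℝ)) ≤ B * (F.P p.K).eta 1 ^ 2 →
      ∀ (D : Finset (Iχ F ν p g 0)) (Kc : ℕ) (E : (j : ℕ) → (Fin j → LabelPat F ν p g) → Finset (LbOfRecord F ν p g j)),
        (∀ h t, t ∈ E 0 h → D ⊆ t.1) →
        ∃ n : ℕ, D.card ≤ 39 ^ (F.P p.K).d * n ∧
          ∑ h ∈ admS (labelTowerOfRecord F N ν M p g A₁ (zeta316OfRecord F N ν M A₁)) (labelPattern F ν p g E) (Kc + 1),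
              ∫ x, (labelTowerOfRecord F N ν M p g A₁ (zeta316OfRecord F N ν M A₁)).eterm (rhoZeroOfRecord F N p.K g₀ E₀) (Kc + 1) h x
                ∂(lawOfRecord F N p.K (Kc + 1)) ≤
            ((((F.P p.K).d ^ 2 * (9 * ((F.P p.K).L * ν.M₂ * RkOfRecord (F.P p.K).L ν.r (g 1))) ^ (F.P p.K).d : ℕ) : ℝ) *
                Real.exp (C * δ₀ - δ₀ * g₀⁻¹ ^ 2 * ((epsOfRecord ν g 1 / B) ^ 2 / (2 * (Fintype.card (Fin N) : ℝ))))) ^ n *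
              ∫ x, rhoZeroOfRecord F N p.K g₀ E₀ x ∂(fieldMeasure (F.P p.K) 0 (SU N)) := by
  obtain ⟨δ₀, hδ₀, C, hC, h35⟩ := sum_admS_integral_le_rec_rootedAtZero_of_overlap F N ν M p g
  refine ⟨δ₀, hδ₀, C, hC, ?_⟩
  intro hK g₀ E₀ hg A₁ hM₂ hM₁ hm hdiv hsz B hB hε1 hB0 D Kc E hE0
  have hη : 0 < (F.P p.K).eta 1 ^ 2 := by
    have : 0 < (F.P p.K).eta 1 := by
      unfold Params.eta
      exact pow_pos (inv_pos.2 (by exact_mod_cast (F.P p.K).L_pos)) _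
    positivity
  have hεη : 0 < epsOfRecord ν g (0 + 1) * (F.P p.K).eta (0 + 1) ^ 2 := mul_pos hε1 hη
  have hreg := hreg_canon_of_crude F N ν p g (k := 0) hm hM₁ hdiv hsz hB hε1 hεη hB0
  have hm1 : 1 ≤ (F.P p.K).d ^ 2 * (9 * ((F.P p.K).L * ν.M₂ * RkOfRecord (F.P p.K).L ν.r (g (0 + 1)))) ^ (F.P p.K).d := by
    have hd : 1 ≤ (F.P p.K).d := (F.P p.K).hd
    have hR : 1 ≤ RkOfRecord (F.P p.K).L ν.r (g (0 + 1)) := B14SeparationOfRecord.one_le_RkOfRecord (F.P p.K).L_pos _ _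
    have hL : 1 ≤ (F.P p.K).L := (F.P p.K).L_pos
    have h9 : 1 ≤ 9 * ((F.P p.K).L * ν.M₂ * RkOfRecord (F.P p.K).L ν.r (g (0 + 1))) := by
      have : 1 ≤ (F.P p.K).L * ν.M₂ * RkOfRecord (F.P p.K).L ν.r (g (0 + 1)) := Nat.one_le_iff_ne_zero.2 (by positivity)
      omega
    exact Nat.one_le_iff_ne_zero.2 (Nat.mul_ne_zero (by positivity) (Nat.pos_iff_ne_zero.1 (Nat.one_le_pow _ _ h9)))
  exact h35 hK g₀ E₀ hg A₁ D
    (fun c => Finset.univ.filter fun q : Plaq (F.P p.K) (0 + 1) => embIter (0 + 1) q.src ∈ cubeEnl (F.P p.K) (sideχ F ν p g 0) c 4)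
    _ (epsOfRecord ν g (0 + 1) / B) (div_pos hε1 hB).le hm1 (fun c _ => card_canon_le F ν p g 0 hm c) (39 ^ (F.P p.K).d)
    (Nat.one_le_pow _ _ (by norm_num)) (fun c _ => card_filter_not_disjoint_canon_le F ν p g 0 hM₂ D c) (fun c _ V' hV' => hreg c V' hV') Kc E hE0

open Classical in
/-- ★★★ **THE ROW's TWO NAMED PROPS FOR KEYS ROOTED AT STEP 0 — NO DISPLAYED LETTER OF BAŁABAN's KIND.**  For every family `D` of χ₁-cubes there is a `39^d`-dense
skeleton `D′ ⊆ D` (pairwise disjoint canonical regions, module 51) such that, for every `B ≥ B₀`, `PointwiseExtraction ∧ LocCondStability` hold on Bałaban's label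
tower at the residual of record (`labelTowerOfRecord A₁ (zeta316OfRecord A₁)`, law `lawOfRecord`, initial density `ρ₀ = rhoZeroOfRecord g₀ E₀`) along every label
pattern `E` pinning `D′` at step `0`, with module 35's indicator carriers at the canonical regions (threshold `ε₁∕B`) and stability exponents
`e^{a₀h}·(m₀·e^{Cδ₀ − δ₀g₀⁻²(ε₁∕B)²∕(2N)})^{#D′} ≤ e^{b₀h}` — module 35's `halves_rec_rootedAtZero` (modulo `hreg` ONLY) with `hreg` := module 59.  What is displayed
is bookkeeping (the carriers' rows) and numerics; NOTHING of [Balaban1985Variational]'s or the cluster expansion's kind.  LOCATED: level `0` only; the exponent is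
gainful iff `δ₀g₀⁻²(ε₁∕B)²∕(2N) > Cδ₀ + log m₀`, a fixed-depth small-coupling condition (module 59's doc).
[cite: Balaban1988Convergent, (3.2) p.265, (3.26)–(3.30) pp.270–271; Balaban1989LargeFieldI, (0.3)–(0.5) pp.176–177; Balaban1985Variational, Thm 1 (9) p.279] -/
theorem halves_rec_rootedAtZero_crude :
    ∃ δ₀ : ℝ, 0 < δ₀ ∧ ∃ C : ℝ, 0 ≤ C ∧ ∀ (_hK : 1 ≤ p.K) (g₀ E₀ : ℝ), 4 * N ≤ g₀⁻¹ ^ 2 → ∀ (A₁ : ℝ)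
      (_hM₂ : 0 < ν.M₂) (_hM₁ : 1 ≤ ν.M₁) (_hm : 1 ≤ (F.P p.K).m + (F.P p.K).K)
      (_hdiv : side (F.P p.K).L ν.M₁ 1 ∣ (F.P p.K).sitesPerDir 0) (_hsz : side (F.P p.K).L ν.M₁ 1 ≤ sideχ F ν p g 0)
      (B : ℝ), 0 < B → 0 < epsOfRecord ν g 1 →
      Real.sqrt ((N : ℝ) * (((F.P p.K).d ^ 2 * (9 * sideχ F ν p g 0) ^ (F.P p.K).d : ℕ) : ℝ)) ≤ B * (F.P p.K).eta 1 ^ 2 →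
      ∀ (D : Finset (Iχ F ν p g 0)), ∃ D' : Finset (Iχ F ν p g 0), D' ⊆ D ∧ D.card ≤ 39 ^ (F.P p.K).d * D'.card ∧
      ∀ (Kc : ℕ) (E : (j : ℕ) → (Fin j → LabelPat F ν p g) → Finset (LbOfRecord F ν p g j))
        (Mc : (j : ℕ) → (Fin j → LabelPat F ν p g) → cfgOfRecord F N p.K j → ℝ) (a b : (j : ℕ) → (Fin j → LabelPat F ν p g) → ℝ),
        (∀ h t, t ∈ E 0 h → D' ⊆ t.1) →
        (∀ (h : Fin 0 → LabelPat F ν p g) (U : cfgOfRecord F N p.K 0), Mc 0 h U = Real.exp (a 0 h) *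
          Set.indicator {U : GaugeField (F.P p.K) 0 (SU N) |
            ∀ c ∈ D', ∃ p' ∈ (Finset.univ.filter fun q : Plaq (F.P p.K) 1 => embIter 1 q.src ∈ cubeEnl (F.P p.K) (sideχ F ν p g 0) c 4),
              epsOfRecord ν g 1 / B ≤ dist1 (GaugeField.plaqHol ((avOfRecord F N p.K 0).avg U) p')} (fun _ => (1 : ℝ)) U) →
        (∀ (j : ℕ) (h : Fin j → LabelPat F ν p g), 1 ≤ j → Mc j h = fun _ => 1) →
        (∀ h : Fin 0 → LabelPat F ν p g, Real.exp (a 0 h) *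
          ((((F.P p.K).d ^ 2 * (9 * ((F.P p.K).L * ν.M₂ * RkOfRecord (F.P p.K).L ν.r (g 1))) ^ (F.P p.K).d : ℕ) : ℝ) *
            Real.exp (C * δ₀ - δ₀ * g₀⁻¹ ^ 2 * ((epsOfRecord ν g 1 / B) ^ 2 / (2 * (Fintype.card (Fin N) : ℝ))))) ^ D'.card ≤
            Real.exp (b 0 h)) →
        (∀ (j : ℕ) (h : Fin j → LabelPat F ν p g), 1 ≤ j → a j h ≤ 0 ∧ 0 ≤ b j h) →
        PointwiseExtraction (labelTowerOfRecord F N ν M p g A₁ (zeta316OfRecord F N ν M A₁)) (labelPattern F ν p g E) Kc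
            (labelChi F N ν M p g A₁ (zeta316OfRecord F N ν M A₁)) Mc a ∧
          LocCondStability (labelTowerOfRecord F N ν M p g A₁ (zeta316OfRecord F N ν M A₁)) (labelPattern F ν p g E) Kc
            (lawOfRecord F N p.K) (rhoZeroOfRecord F N p.K g₀ E₀) Mc b := by
  obtain ⟨δ₀, hδ₀, C, hC, h35⟩ := halves_rec_rootedAtZero F N ν M p g
  refine ⟨δ₀, hδ₀, C, hC, ?_⟩
  intro hK g₀ E₀ hg A₁ hM₂ hM₁ hm hdiv hsz B hB hε1 hB0 D
  obtain ⟨D', hD'D, hdisj, hcard⟩ := exists_canon_skeleton F ν p g 0 hM₂ D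
  refine ⟨D', hD'D, hcard, ?_⟩
  intro Kc E Mc a b hE0 hM0 hMj hb0 habj
  have hη : 0 < (F.P p.K).eta 1 ^ 2 := by
    have : 0 < (F.P p.K).eta 1 := by
      unfold Params.eta
      exact pow_pos (inv_pos.2 (by exact_mod_cast (F.P p.K).L_pos)) _
    positivity
  have hεη : 0 < epsOfRecord ν g (0 + 1) * (F.P p.K).eta (0 + 1) ^ 2 := mul_pos hε1 hη
  have hreg := hreg_canon_of_crude F N ν p g (k := 0) hm hM₁ hdiv hsz hB hε1 hεη hB0
  exact h35 hK g₀ E₀ hg A₁ D'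
    (fun c => Finset.univ.filter fun q : Plaq (F.P p.K) (0 + 1) => embIter (0 + 1) q.src ∈ cubeEnl (F.P p.K) (sideχ F ν p g 0) c 4)
    _ (epsOfRecord ν g (0 + 1) / B) (div_pos hε1 hB).le (fun c _ => card_canon_le F ν p g 0 hm c) hdisj
    (fun c _ V' hV' => hreg c V' hV') Kc E Mc a b hE0 hM0 hMj hb0 habj

end RootedAtZero

end Summit.QuantumFields.YangMills.BalabanUVNodes.N20LCSThm1Crude

end
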